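import Summits.ResolutionOfSingularities.ResolutionOfSingularities.Theorems.HilbertSamuelEliminationCampaignW42TertiaryGeneralStrata
import Summits.ResolutionOfSingularities.ResolutionOfSingularities.Theorems.HilbertSamuelEliminationSigmaMaxModificationsCorridor3RegimeGlue
import HarnessLib

/-!
# [OURS · L1 W4.2] THE CALIBRATION AGAINST CORRIDOR3: `SigmaMaxModificationsCorridor3` (stmt-ResolutionOfSingularities-19249)
# — indeed `Σ^max`-modifications for ALL reduced schemes of dimension `≤ 3` over a field — FOLLOWS from CJS Thm. 1.2
# (named fact) and the pointwise O2-type termination statement for threefolds (`--supports stmt-…-17846`)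

OURS (slot W4.2 of cell res-hironaka, LADDER-RESOLUTION rung L, D-0089; prover seat res-L1-s42-pv-2, gen 2); NOT
statements of H. Hironaka's manuscript [Hironaka2017]; nothing of the manuscript is used or asserted. AI review is
weaker than expert review. Pure PROOF file; no new definition. It does NOT close stmt-…-19249: the route decl is
obtained UNDER two hypotheses, displayed verbatim — (A) the printed CJS Thm. 1.2 as the tree's named fact
`CossartJannsenSaito2020SequencePermissible` (undischarged), and (B) the O2-TYPE STATEMENT FOR THREEFOLDS (OPEN):

  (B) for every field `k`, every reduced `Y` of finite type over `k` with `dim Y ≤ 3`, `dim Y ≤ N`, every maximal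
      `ν ≠ Φ^{(N)}`, every functional admissible oracle `R` answering on resolvable schemes, and every CLOSED point
      `y ∈ Y(ν)`: NO infinite chain of closed near points `y = y_0 ← y_1 ← ⋯` along `S(Y, ν)`
      (`NoNearChainFrom R N ν (MarkedStage.init Y y) ⊤`; CJS p. 107 «no infinite sequence of closed points
      x_n ∈ X_n(ν̃) … x_{n+1} lies above x_n», WITHOUT «e = ē = 2»).

(B) contains the typed O2 open item of the OURS statement file (`TertiaryTermination p`, its isolated-origin
instance, all characteristics at once) and is what CJS's Key Theorems 6.35/6.40 establish for `ē ≤ 2`.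

* `nuMods_dim_le_three_of_noNearChains` — (A) + (B) ⇒ `TameWild.NuMod Y N 3 ν` on the whole class `{dim ≤ 3}`
  (GeneralStrata file `nuMod_threefold_of_noNearChains`, p486671).
* `hsBody_dim_le_three_of_noNearChains` — ⇒ the crux body `B(X, N)` (`TameWild.HSBody`, CJS Def. 6.15 in modification
  form) for every non-regular reduced separated `X` of finite type over a field of dimension `≤ 3` and every
  `N ≥ dim X`, by the landed graded glue (`TameWild.hsBody_of_nuMods'`, res-L1-w42 chain: CJS Def. 6.14 → 6.15,
  closed `X_max`, dense complement).
* `sigmaMaxModificationsCorridor3_of_noNearChains` — ⇒ THE ROUTE DECL `SigmaMaxModificationsCorridor3` (through the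
  landed `rfl`-bridge `TameWild.sigmaMaxModificationsCorridor3_iff`); the corridor hypothesis and `3 ≤ dim X` are not
  even used. Reading: MODULO THE PRINTED RESOLUTION OF EXCELLENT SURFACES, THE ATTACKED CONJUNCT OF ROUTE
  HilbertSamuelElimination IS IMPLIED BY THE O2-TYPE TERMINATION OF CJS's OWN STRATEGY ON THREEFOLDS — the kernel
  form of the W4.2 lever «replace the invariant's home by the Hilbert–Samuel architecture» and of CRUX-PLAN v2 §4
  («the engine wanted is a termination argument at finitely many closed points with `e_x = 3`»; here: at every closed
  point of every maximal stratum, no confinement needed).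

## References

* V. Cossart, U. Jannsen, S. Saito, LNM 2270 (2020), Thm. 1.2, Def. 6.14, Def. 6.15, Rem. 6.24, Rem. 6.29 (1), p. 107,
  Thms. 6.35/6.40. [CossartJannsenSaito2020]
* route file Theses/HilbertSamuelElimination.lean (stmt-…-19249); L/w42/CRUX-PLAN-v2.md §4; L/res-L1-w42-lead-1/tame_wild_current.lean.
-/

noncomputable section

set_option linter.dupNamespace false -- mandated namespace of this single-conjunct summit

open CategoryTheory AlgebraicGeometry TopologicalSpace Topology IsLocalRing

namespace Summit.ResolutionOfSingularities.ResolutionOfSingularities.Theorems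

namespace CampaignW42

open Literature.AlgebraicGeometry.Resolution Literature.RingTheory.HilbertSamuel
open Summit.ResolutionOfSingularities.ResolutionOfSingularities.Theses.HilbertSamuelElimination
open Summit.ResolutionOfSingularities.ResolutionOfSingularities.Theorems.SigmaMaxModificationsCorridor3

/-! ## `ν`-modifications on the class `{dim ≤ 3}` from (A) + (B) -/

/-- **(A) CJS Thm. 1.2 + (B) the pointwise O2-type statement for threefolds ⇒ `ν`-modifications on the whole class of
reduced separated finite-type `Y/k` with `dim Y ≤ 3`, `dim Y ≤ N`, at every maximal `ν ≠ Φ^{(N)}`** — the hypothesis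
`hmod` of the landed graded glue, with `d = 3`. [cite: CossartJannsenSaito2020, Thm. 1.2, Def. 6.14, Rem. 6.29 (1), p. 107] -/
theorem nuMods_dim_le_three_of_noNearChains (hCJS : CossartJannsenSaito2020SequencePermissible.{0})
    (hO2 : ∀ (k : Type) [Field k] (Y : Scheme.{0}) [IsLocallyNoetherian Y] (g : Y ⟶ Spec (.of k))
      [LocallyOfFiniteType g] [QuasiCompact g] [IsReduced Y] (N : ℕ) (ν : ℕ → ℕ),
      topologicalKrullDim Y ≤ ((3 : ℕ) : WithBot ℕ∞) → topologicalKrullDim Y ≤ (N : WithBot ℕ∞) →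
      Maximal (· ∈ Scheme.hsValues Y N) ν → ν ≠ iterPSum N Phi →
      ∀ R : ∀ S : Scheme.{0}, CentreSeq S → Prop, OracleFunctional R → OracleAdmissible R →
        (∀ S : Scheme.{0}, (∃ t : CentreSeq S, t.AllPermissible ∧ t.CentresOver (Scheme.regularLocus S)ᶜ ∧
          Literature.AlgebraicGeometry.Resolution.Scheme.IsRegular t.top) → ∃ t, R S t) →
        ∀ y ∈ Scheme.hsStratum Y N ν, IsClosed ({y} : Set Y) →
          NoNearChainFrom R N ν (MarkedStage.init Y y) fun _ => True)
    (k : Type) [Field k] (N : ℕ) :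
    ∀ (Y : Scheme.{0}) (g : Y ⟶ Spec (.of k)), IsSeparated g → LocallyOfFiniteType g → QuasiCompact g →
      IsReduced Y → topologicalKrullDim Y ≤ ((3 : ℕ) : WithBot ℕ∞) → topologicalKrullDim Y ≤ (N : WithBot ℕ∞) →
      ∀ ν : ℕ → ℕ, Maximal (· ∈ Scheme.hsValues Y N) ν → ν ≠ iterPSum N Phi → TameWild.NuMod Y N 3 ν := by
  intro Y g _ hft hqc hred hd3 hdN ν hν hνΦ
  haveI := hft
  haveI := hqc
  haveI := hred
  haveI : IsLocallyNoetherian Y := LocallyOfFiniteType.isLocallyNoetherian g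
  exact nuMod_threefold_of_noNearChains hCJS g hd3 hdN hd3 hν hνΦ
    fun R hRf hRa hRtot => hO2 k Y g N ν hd3 hdN hν hνΦ R hRf hRa hRtot

/-! ## The crux body and the route decl -/

/-- **(A) + (B) ⇒ THE CRUX BODY `B(X, N)` ON `{dim ≤ 3}`**: for every non-regular reduced separated `X` of finite type
over a field with `dim X ≤ 3` and every level `N ≥ dim X`, a `Σ^max`-modification at level `N` (CJS Def. 6.15 in
modification form, `TameWild.HSBody`) — by the landed graded glue `TameWild.hsBody_of_nuMods'`.
[cite: CossartJannsenSaito2020, Def. 6.15, Rem. 6.24, Thm. 1.2, p. 107] -/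
theorem hsBody_dim_le_three_of_noNearChains (hCJS : CossartJannsenSaito2020SequencePermissible.{0})
    (hO2 : ∀ (k : Type) [Field k] (Y : Scheme.{0}) [IsLocallyNoetherian Y] (g : Y ⟶ Spec (.of k))
      [LocallyOfFiniteType g] [QuasiCompact g] [IsReduced Y] (N : ℕ) (ν : ℕ → ℕ),
      topologicalKrullDim Y ≤ ((3 : ℕ) : WithBot ℕ∞) → topologicalKrullDim Y ≤ (N : WithBot ℕ∞) →
      Maximal (· ∈ Scheme.hsValues Y N) ν → ν ≠ iterPSum N Phi →
      ∀ R : ∀ S : Scheme.{0}, CentreSeq S → Prop, OracleFunctional R → OracleAdmissible R →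
        (∀ S : Scheme.{0}, (∃ t : CentreSeq S, t.AllPermissible ∧ t.CentresOver (Scheme.regularLocus S)ᶜ ∧
          Literature.AlgebraicGeometry.Resolution.Scheme.IsRegular t.top) → ∃ t, R S t) →
        ∀ y ∈ Scheme.hsStratum Y N ν, IsClosed ({y} : Set Y) →
          NoNearChainFrom R N ν (MarkedStage.init Y y) fun _ => True)
    (k : Type) [Field k] (N : ℕ) (X : Scheme.{0}) (f : X ⟶ Spec (.of k)) (hsep : IsSeparated f)
    (hft : LocallyOfFiniteType f) (hqc : QuasiCompact f) (hred : IsReduced X) (hreg : ¬ Scheme.IsRegular X)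
    (hd3 : topologicalKrullDim X ≤ ((3 : ℕ) : WithBot ℕ∞)) (hdN : topologicalKrullDim X ≤ (N : WithBot ℕ∞)) :
    TameWild.HSBody X N :=
  TameWild.hsBody_of_nuMods' k N 3 (nuMods_dim_le_three_of_noNearChains hCJS hO2 k N) X f hsep hft hqc hred hreg
    hd3 hdN

/-- **THE CALIBRATION: `SigmaMaxModificationsCorridor3` (stmt-ResolutionOfSingularities-19249) FOLLOWS FROM (A) CJS
Thm. 1.2 AND (B) THE POINTWISE O2-TYPE TERMINATION STATEMENT FOR THREEFOLDS.** The route decl is concluded BY NAME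
through the landed `rfl`-bridge `TameWild.sigmaMaxModificationsCorridor3_iff`; the corridor hypothesis is not used.
Conditional theorem — it does not close the item: (A) is an undischarged named fact and (B) is OPEN (it contains O2).
[cite: CossartJannsenSaito2020, Def. 6.15, Rem. 6.29 (1), Thm. 1.2, p. 107] -/
theorem sigmaMaxModificationsCorridor3_of_noNearChains (hCJS : CossartJannsenSaito2020SequencePermissible.{0})
    (hO2 : ∀ (k : Type) [Field k] (Y : Scheme.{0}) [IsLocallyNoetherian Y] (g : Y ⟶ Spec (.of k))
      [LocallyOfFiniteType g] [QuasiCompact g] [IsReduced Y] (N : ℕ) (ν : ℕ → ℕ),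
      topologicalKrullDim Y ≤ ((3 : ℕ) : WithBot ℕ∞) → topologicalKrullDim Y ≤ (N : WithBot ℕ∞) →
      Maximal (· ∈ Scheme.hsValues Y N) ν → ν ≠ iterPSum N Phi →
      ∀ R : ∀ S : Scheme.{0}, CentreSeq S → Prop, OracleFunctional R → OracleAdmissible R →
        (∀ S : Scheme.{0}, (∃ t : CentreSeq S, t.AllPermissible ∧ t.CentresOver (Scheme.regularLocus S)ᶜ ∧
          Literature.AlgebraicGeometry.Resolution.Scheme.IsRegular t.top) → ∃ t, R S t) →
        ∀ y ∈ Scheme.hsStratum Y N ν, IsClosed ({y} : Set Y) →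
          NoNearChainFrom R N ν (MarkedStage.init Y y) fun _ => True) :
    SigmaMaxModificationsCorridor3 := by
  rw [TameWild.sigmaMaxModificationsCorridor3_iff]
  intro p _ k _ _ X f hsep hft hqc hred hreg _ hd3 N hdN _
  exact hsBody_dim_le_three_of_noNearChains hCJS hO2 k N X f hsep hft hqc hred hreg hd3 hdN

end CampaignW42

end Summit.ResolutionOfSingularities.ResolutionOfSingularities.Theorems

end
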